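import Summits.PneNP.PneNP.Theorems.SzkEntropyPeaThreeNotInPSocketRawDefs
import Literature.Computability.Complexity.DegreeThreeEncodingMapFP
import Literature.Computability.Complexity.CodeFPListKit
import Literature.Computability.Complexity.CodeFPLists
import HarnessLib

/-!
# Route SzkEntropy, crux `PeaThreeNotInP` (stmt-PneNP-10776), line `SketchIdeator3`, socket rider:
# the raw instance map `PEA d → PEABP` is typed polynomial time

The converse socket direction `PEA d ≤ₚ PEABP` sends a sparse polynomial map over `F₂` to the
list of the PARITY PROGRAMS of its output polynomials (`parityRaw`, a width-2 layered branching
program per polynomial, `SzkEntropyPeaThreeNotInPSocketRawDefs`). This file proves the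
polynomial-time clause of that Karp reduction: the raw instance map
`toPEABPRaw (n, P, k) = (n, P.map parityRaw, k)` is `CodeFP` between the codes of `PEA` and of
`PEABP` instances (`stub_toPEABPRawFP`).

The program is assembled from the typed combinators of `CodeFP.lean`: the decision chain of a
monomial is a `mapIdx` over the reversed monomial (`codeFP_chainRaw`), one step of the parity
fold is list concatenation and binary arithmetic (`codeFP_parityStep`), and the fold itself is
`CodeFP.foldl`, whose one hypothesis — a polynomial bound on the code of the accumulator along the
run — is discharged by the size invariant of the parity program: after the monomials `l` the
program has `2 + 2 Σ_{μ ∈ l} |μ|` nodes, and every node is one of the two initial sinks or a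
decision node `(2, x, kb, kf)` with `x` a variable of `l` and `kb, kf` at most the current number
of nodes (`mem_foldl_parityStep`), whence a quadratic bound (`length_parityFold_le`).

## References

* S. Arora, B. Barak, *Computational Complexity: A Modern Approach*, CUP 2009, §1.3 (closure of
  polynomial time under composition and polynomially bounded loops).
* I. Wegener, *Branching programs and binary decision diagrams*, SIAM 2000, §1.1.
-/

namespace Summit.PneNP.PneNP.Cruxes.PeaThreeNotInP.SocketBP

set_option linter.dupNamespace false

open Literature.Computability.Complexity
open CodeFP (natE pairE rawE listE bitE)
open Polynomial

namespace ParityFP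

/-! ### The parity fold: sizes and the node invariant -/

/-- A chain has one node per variable of the monomial. [folklore] -/
theorem length_chainRaw (μ : List ℕ) (start kb kf : ℕ) :
    (chainRaw μ start kb kf).length = μ.length := by
  simp [chainRaw]

/-- The nodes of a chain are decision nodes on variables of the monomial pointing to `kb`, to `kf`
or into the chain. [folklore] -/
theorem mem_chainRaw {μ : List ℕ} {start kb kf : ℕ} {nd : ℕ × ℕ × ℕ × ℕ}
    (h : nd ∈ chainRaw μ start kb kf) :
    nd.1 = 2 ∧ nd.2.1 ∈ μ ∧ nd.2.2.1 = kb ∧ (nd.2.2.2 = kf ∨ nd.2.2.2 < start + μ.length) := by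
  unfold chainRaw at h
  obtain ⟨xj, hxj, rfl⟩ := List.mem_map.1 h
  have hx : xj.1 ∈ μ := List.mem_reverse.1 (List.fst_mem_of_mem_zipIdx hxj)
  have hj : xj.2 < μ.reverse.length + 0 := List.snd_lt_of_mem_zipIdx hxj
  rw [List.length_reverse, Nat.add_zero] at hj
  refine ⟨rfl, hx, rfl, ?_⟩
  dsimp only
  split_ifs with h0
  · exact Or.inl rfl
  · exact Or.inr (by omega)

/-- The chain as an indexed map over the reversed monomial. [folklore] -/
theorem chainRaw_eq_mapIdx (μ : List ℕ) (start kb kf : ℕ) :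
    chainRaw μ start kb kf =
      μ.reverse.mapIdx fun j x => (2, x, kb, if j = 0 then kf else start + j - 1) := by
  rw [chainRaw, List.mapIdx_eq_zipIdx_map]

/-- The node list of one step of the fold. [folklore] -/
theorem parityStep_fst (st : List (ℕ × ℕ × ℕ × ℕ) × ℕ × ℕ) (μ : List ℕ) :
    (parityStep st μ).1 = st.1 ++ chainRaw μ st.1.length st.2.2 st.2.1 ++
      chainRaw μ (st.1.length + μ.length) st.2.1 st.2.2 := rfl

/-- The first continuation after one step. [folklore] -/
theorem parityStep_snd_fst (st : List (ℕ × ℕ × ℕ × ℕ) × ℕ × ℕ) (μ : List ℕ) :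
    (parityStep st μ).2.1 = st.1.length + 2 * μ.length - 1 := rfl

/-- The second continuation after one step. [folklore] -/
theorem parityStep_snd_snd (st : List (ℕ × ℕ × ℕ × ℕ) × ℕ × ℕ) (μ : List ℕ) :
    (parityStep st μ).2.2 = st.1.length + μ.length - 1 := rfl

/-- One step adds `2|μ|` nodes. [folklore] -/
theorem length_parityStep_fst (st : List (ℕ × ℕ × ℕ × ℕ) × ℕ × ℕ) (μ : List ℕ) :
    (parityStep st μ).1.length = st.1.length + 2 * μ.length := by
  rw [parityStep_fst, List.length_append, List.length_append, length_chainRaw, length_chainRaw]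
  omega

/-- Number of nodes after a run of the parity fold. [folklore] -/
theorem length_foldl_parityStep (l : List (List ℕ)) :
    ∀ st : List (ℕ × ℕ × ℕ × ℕ) × ℕ × ℕ,
      (l.foldl parityStep st).1.length = st.1.length + 2 * (l.map List.length).sum := by
  induction l with
  | nil => intro st; simp
  | cons μ l ih =>
    intro st
    rw [List.foldl_cons, ih, length_parityStep_fst, List.map_cons, List.sum_cons]
    omega

/-- The two continuations stay within the node list along a run. [folklore] -/
theorem foldl_parityStep_snd_le (l : List (List ℕ)) :
    ∀ st : List (ℕ × ℕ × ℕ × ℕ) × ℕ × ℕ, st.2.1 ≤ st.1.length → st.2.2 ≤ st.1.length →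
      (l.foldl parityStep st).2.1 ≤ (l.foldl parityStep st).1.length ∧
        (l.foldl parityStep st).2.2 ≤ (l.foldl parityStep st).1.length := by
  induction l with
  | nil => intro st h1 h2; exact ⟨h1, h2⟩
  | cons μ l ih =>
    intro st _ _
    rw [List.foldl_cons]
    have hlen := length_parityStep_fst st μ
    apply ih
    · rw [parityStep_snd_fst, hlen]; omega
    · rw [parityStep_snd_snd, hlen]; omega

/-- **The node invariant of the parity fold**: every node of a run is a node of the initial state
or a decision node on a variable of the folded monomials whose two successors lie in the final
node list. [folklore] -/
theorem mem_foldl_parityStep (l : List (List ℕ)) :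
    ∀ st : List (ℕ × ℕ × ℕ × ℕ) × ℕ × ℕ, st.2.1 ≤ st.1.length → st.2.2 ≤ st.1.length →
      ∀ nd ∈ (l.foldl parityStep st).1, nd ∈ st.1 ∨
        (nd.1 = 2 ∧ nd.2.1 ∈ l.flatten ∧ nd.2.2.1 ≤ (l.foldl parityStep st).1.length ∧
          nd.2.2.2 ≤ (l.foldl parityStep st).1.length) := by
  induction l with
  | nil => intro st _ _ nd hnd; exact Or.inl hnd
  | cons μ l ih =>
    intro st h1 h2 nd hnd
    rw [List.foldl_cons] at hnd ⊢
    have hlen := length_parityStep_fst st μ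
    have hs1 : (parityStep st μ).2.1 ≤ (parityStep st μ).1.length := by
      rw [parityStep_snd_fst, hlen]; omega
    have hs2 : (parityStep st μ).2.2 ≤ (parityStep st μ).1.length := by
      rw [parityStep_snd_snd, hlen]; omega
    have hmono : (parityStep st μ).1.length ≤ (l.foldl parityStep (parityStep st μ)).1.length := by
      rw [length_foldl_parityStep l (parityStep st μ)]; omega
    rcases ih (parityStep st μ) hs1 hs2 nd hnd with h | ⟨ht, hx, hkb, hkf⟩
    · rw [parityStep_fst, List.mem_append, List.mem_append] at h
      rcases h with (h | h) | h
      · exact Or.inl h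
      · obtain ⟨ht, hx, hkb, hkf⟩ := mem_chainRaw h
        refine Or.inr ⟨ht, List.mem_flatten.2 ⟨μ, List.mem_cons_self .., hx⟩, ?_, ?_⟩
        · rw [hkb]; omega
        · rcases hkf with hkf | hkf
          · rw [hkf]; omega
          · omega
      · obtain ⟨ht, hx, hkb, hkf⟩ := mem_chainRaw h
        refine Or.inr ⟨ht, List.mem_flatten.2 ⟨μ, List.mem_cons_self .., hx⟩, ?_, ?_⟩
        · rw [hkb]; omega
        · rcases hkf with hkf | hkf
          · rw [hkf]; omega
          · omega
    · obtain ⟨ν, hν, hxν⟩ := List.mem_flatten.1 hx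
      exact Or.inr ⟨ht, List.mem_flatten.2 ⟨ν, List.mem_cons_of_mem μ hν, hxν⟩, hkb, hkf⟩

/-! ### Code sizes along the fold -/

/-- The monomial sizes are within the code of the polynomial. [folklore] -/
theorem sum_length_le_length_rawE (l : List (List ℕ)) :
    (l.map List.length).sum ≤ (rawE (rawE natE) l).length := by
  induction l with
  | nil => simp
  | cons μ l ih =>
    rw [List.map_cons, List.sum_cons, CodeFP.rawE_cons, length_boolPair]
    have := CodeFP.length_le_length_rawE natE μ
    omega

/-- A variable of the polynomial has a code shorter than the polynomial's. [folklore] -/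
theorem length_natE_le_of_mem_flatten {x : ℕ} {l : List (List ℕ)} (h : x ∈ l.flatten) :
    (natE x).length ≤ (rawE (rawE natE) l).length := by
  obtain ⟨μ, hμ, hx⟩ := List.mem_flatten.1 h
  have h1 := CodeFP.length_item_le_length_rawE natE hx
  have h2 := CodeFP.length_item_le_length_rawE (rawE natE) hμ
  omega

/-- **The accumulator bound of the parity fold**: started from two sinks with tags `≤ 1`, after
the monomials `l` (of code length `≤ W`) the state has code length at most `200 (W + 1)²`.
[folklore] -/
theorem length_parityFold_le (W c c' : ℕ) (hc : c ≤ 1) (hc' : c' ≤ 1) (l : List (List ℕ))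
    (hW : (rawE (rawE natE) l).length ≤ W) :
    (pairE (rawE (pairE natE (pairE natE (pairE natE natE)))) (pairE natE natE)
      (l.foldl parityStep ([(c, 0, 0, 0), (c', 0, 0, 0)], 1, 0))).length ≤ 200 * ((W + 1) * (W + 1)) := by
  have hsum : (l.map List.length).sum ≤ W := (sum_length_le_length_rawE l).trans hW
  have hlen := length_foldl_parityStep l ([(c, 0, 0, 0), (c', 0, 0, 0)], 1, 0)
  have hk := foldl_parityStep_snd_le l ([(c, 0, 0, 0), (c', 0, 0, 0)], 1, 0) (by simp) (by simp)
  have hmem := mem_foldl_parityStep l ([(c, 0, 0, 0), (c', 0, 0, 0)], 1, 0) (by simp) (by simp)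
  generalize l.foldl parityStep ([(c, 0, 0, 0), (c', 0, 0, 0)], 1, 0) = R at hlen hk hmem ⊢
  have hN : R.1.length ≤ 2 * W + 2 := by
    rw [hlen]; simp only [List.length_cons, List.length_nil]; omega
  have hnode : ∀ nd ∈ R.1,
      (pairE natE (pairE natE (pairE natE natE)) nd).length ≤ 8 * W + 16 := by
    intro nd hnd
    rcases hmem nd hnd with h | ⟨ht, hx, hkb, hkf⟩
    · have key : ∀ a : ℕ, a ≤ 1 →
          (pairE natE (pairE natE (pairE natE natE)) (a, 0, 0, 0)).length ≤ 8 * W + 16 := fun a ha => by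
        have := CodeFP.length_natE_le a
        simp only [CodeFP.pairE_apply, length_boolPair, CodeFP.natE_zero, List.length_nil]
        omega
      simp only [List.mem_cons, List.not_mem_nil, or_false] at h
      rcases h with rfl | rfl
      · exact key c hc
      · exact key c' hc'
    · obtain ⟨t, x, kb, kf⟩ := nd
      dsimp only at ht hx hkb hkf
      subst ht
      have hxW : (natE x).length ≤ W := (length_natE_le_of_mem_flatten hx).trans hW
      have h2 := CodeFP.length_natE_le 2
      have hkbW := CodeFP.length_natE_le kb
      have hkfW := CodeFP.length_natE_le kf
      simp only [CodeFP.pairE_apply, length_boolPair]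
      omega
  have hraw : (rawE (pairE natE (pairE natE (pairE natE natE))) R.1).length ≤
      R.1.length * (16 * W + 34) := by
    rw [CodeFP.length_rawE]
    calc (R.1.map fun nd => 2 * (pairE natE (pairE natE (pairE natE natE)) nd).length + 2).sum
        ≤ (R.1.map fun nd => 2 * (pairE natE (pairE natE (pairE natE natE)) nd).length + 2).length •
            (16 * W + 34) :=
          List.sum_le_card_nsmul _ _ fun y hy => by
            obtain ⟨nd, hnd, rfl⟩ := List.mem_map.1 hy
            have := hnode nd hnd
            omega
      _ = R.1.length * (16 * W + 34) := by rw [List.length_map, smul_eq_mul]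
  have hprod : R.1.length * (16 * W + 34) ≤ (2 * W + 2) * (16 * W + 34) :=
    Nat.mul_le_mul_right _ hN
  have hk0 := CodeFP.length_natE_le R.2.1
  have hk1 := CodeFP.length_natE_le R.2.2
  obtain ⟨hk0', hk1'⟩ := hk
  simp only [CodeFP.pairE_apply, length_boolPair]
  nlinarith [hraw, hprod, hk0, hk1, hk0', hk1', hN]

/-! ### The programs -/

/-- **The decision chain on codes** (argument `(μ, start, kb, kf)`). [cite: AroraBarak2009, §1.3] -/
theorem codeFP_chainRaw : CodeFP (pairE (rawE natE) (pairE natE (pairE natE natE)))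
    (rawE (pairE natE (pairE natE (pairE natE natE)))) (fun c => chainRaw c.1 c.2.1 c.2.2.1 c.2.2.2) := by
  -- item `(ctx, j, x)` with `ctx = (start, kb, kf)`
  let cE := pairE (pairE natE (pairE natE natE)) (pairE natE natE)
  have hS : CodeFP cE natE (fun t => t.1.1) := (CodeFP.fst _ _).fst'
  have hKb : CodeFP cE natE (fun t => t.1.2.1) := (CodeFP.fst _ _).snd'.fst'
  have hKf : CodeFP cE natE (fun t => t.1.2.2) := (CodeFP.fst _ _).snd'.snd'
  have hJ : CodeFP cE natE (fun t => t.2.1) := (CodeFP.snd _ _).fst'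
  have hX : CodeFP cE natE (fun t => t.2.2) := (CodeFP.snd _ _).snd'
  have hlast : CodeFP cE natE (fun t => if t.2.1 = 0 then t.1.2.2 else t.1.1 + t.2.1 - 1) :=
    ((CodeFP.natEq.comp (hJ.pair (CodeFP.const _ 0))).ite hKf
      (CodeFP.natSub.comp ((CodeFP.natAdd.comp (hS.pair hJ)).pair (CodeFP.const _ 1)))).congr
      fun t => by simp only [decide_eq_true_eq]
  have hg : CodeFP cE (pairE natE (pairE natE (pairE natE natE)))
      (fun t => ((2 : ℕ), t.2.2, t.1.2.1, if t.2.1 = 0 then t.1.2.2 else t.1.1 + t.2.1 - 1)) :=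
    (CodeFP.const _ 2).pair (hX.pair (hKb.pair hlast))
  refine ((CodeFP.mapIdx (σ := ℕ × ℕ × ℕ) (α := ℕ) hg).comp
    ((CodeFP.snd _ _).pair ((CodeFP.rawReverse natE).comp (CodeFP.fst _ _)))).congr fun c => ?_
  exact (chainRaw_eq_mapIdx c.1 c.2.1 c.2.2.1 c.2.2.2).symm

/-- **One step of the parity fold on codes** (argument `(μ, state)`). [cite: AroraBarak2009, §1.3] -/
theorem codeFP_parityStep :
    CodeFP (pairE (rawE natE) (pairE (rawE (pairE natE (pairE natE (pairE natE natE)))) (pairE natE natE)))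
      (pairE (rawE (pairE natE (pairE natE (pairE natE natE)))) (pairE natE natE))
      (fun t => parityStep t.2 t.1) := by
  let ndE := pairE natE (pairE natE (pairE natE natE))
  let cE := pairE (rawE natE) (pairE (rawE ndE) (pairE natE natE))
  have hM : CodeFP cE (rawE natE) (fun t => t.1) := CodeFP.fst _ _
  have hB : CodeFP cE (rawE ndE) (fun t => t.2.1) := (CodeFP.snd _ _).fst'
  have hK0 : CodeFP cE natE (fun t => t.2.2.1) := (CodeFP.snd _ _).snd'.fst'
  have hK1 : CodeFP cE natE (fun t => t.2.2.2) := (CodeFP.snd _ _).snd'.snd'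
  have hS : CodeFP cE natE (fun t => t.2.1.length) := (CodeFP.natLength _).comp hB
  have hD : CodeFP cE natE (fun t => t.1.length) := (CodeFP.natLength natE).comp hM
  have hSD : CodeFP cE natE (fun t => t.2.1.length + t.1.length) := CodeFP.natAdd.comp (hS.pair hD)
  have h2D : CodeFP cE natE (fun t => 2 * t.1.length) :=
    CodeFP.natMul.comp ((CodeFP.const _ 2).pair hD)
  have hC1 : CodeFP cE (rawE ndE) (fun t => chainRaw t.1 t.2.1.length t.2.2.2 t.2.2.1) :=
    codeFP_chainRaw.comp (hM.pair (hS.pair (hK1.pair hK0)))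
  have hC2 : CodeFP cE (rawE ndE) (fun t => chainRaw t.1 (t.2.1.length + t.1.length) t.2.2.1 t.2.2.2) :=
    codeFP_chainRaw.comp (hM.pair (hSD.pair (hK0.pair hK1)))
  have hNodes : CodeFP cE (rawE ndE) (fun t => t.2.1 ++ chainRaw t.1 t.2.1.length t.2.2.2 t.2.2.1 ++
      chainRaw t.1 (t.2.1.length + t.1.length) t.2.2.1 t.2.2.2) :=
    (CodeFP.rawAppend _).comp (((CodeFP.rawAppend _).comp (hB.pair hC1)).pair hC2)
  have hN0 : CodeFP cE natE (fun t => t.2.1.length + 2 * t.1.length - 1) :=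
    CodeFP.natSub.comp ((CodeFP.natAdd.comp (hS.pair h2D)).pair (CodeFP.const _ 1))
  have hN1 : CodeFP cE natE (fun t => t.2.1.length + t.1.length - 1) :=
    CodeFP.natSub.comp (hSD.pair (CodeFP.const _ 1))
  exact (hNodes.pair (hN0.pair hN1)).congr fun t => rfl

/-- **The parity fold on codes** (context: the parity bit of the empty monomials, which fixes the
two sinks). [cite: AroraBarak2009, §1.3 (polynomially bounded loops)] -/
theorem codeFP_parityFold : CodeFP (pairE bitE (rawE (rawE natE)))
    (pairE (rawE (pairE natE (pairE natE (pairE natE natE)))) (pairE natE natE))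
    (fun p => p.2.foldl parityStep
      ([(if p.1 then 0 else 1, 0, 0, 0), (if p.1 then 1 else 0, 0, 0, 0)], 1, 0)) := by
  let stE := pairE (rawE (pairE natE (pairE natE (pairE natE natE)))) (pairE natE natE)
  have hstep : CodeFP (pairE bitE (pairE (rawE natE) stE)) stE (fun t => parityStep t.2.2 t.2.1) :=
    codeFP_parityStep.comp (CodeFP.snd _ _)
  have hinit : CodeFP bitE stE
      (fun b => ([(if b then 0 else 1, 0, 0, 0), (if b then 1 else 0, 0, 0, 0)], 1, 0)) :=
    CodeFP.ofFintype CodeFP.bitE_injective _ _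
  refine CodeFP.foldl (σ := Bool) (α := List ℕ) (β := List (ℕ × ℕ × ℕ × ℕ) × ℕ × ℕ)
    (eσ := bitE) (eα := rawE natE)
    (step := fun _ μ st => parityStep st μ)
    (init := fun b => ([(if b then 0 else 1, 0, 0, 0), (if b then 1 else 0, 0, 0, 0)], 1, 0))
    hstep hinit (200 * (X * X)) fun b l₁ l₂ => ?_
  have hb1 : (if b then 0 else 1) ≤ 1 := by cases b <;> simp
  have hb2 : (if b then 1 else 0) ≤ 1 := by cases b <;> simp
  refine (length_parityFold_le _ _ _ hb1 hb2 l₁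
    (CodeFP.length_rawE_le_of_sublist _ (List.sublist_append_left l₁ l₂))).trans ?_
  simp only [eval_mul, eval_X, eval_ofNat, CodeFP.pairE_apply, length_boolPair]
  have h1 : (rawE (rawE natE) (l₁ ++ l₂)).length + 1 ≤
      2 * (bitE b).length + 2 + (rawE (rawE natE) (l₁ ++ l₂)).length := by omega
  exact Nat.mul_le_mul_left _ (Nat.mul_le_mul h1 h1)

/-- The parity bit of the empty monomials, on codes. [cite: AroraBarak2009, §1.3] -/
theorem codeFP_oddBit : CodeFP (rawE (rawE natE)) bitE
    (fun p => decide ((p.filter fun μ => μ.isEmpty).length % 2 = 1)) := by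
  have hf : CodeFP (rawE (rawE natE)) (rawE (rawE natE)) (fun p => p.filter fun μ => μ.isEmpty) :=
    ((CodeFP.filter (σ := Unit) (α := List ℕ) (eσ := CodeFP.unitE)
      ((CodeFP.rawIsEmpty natE).comp (CodeFP.snd CodeFP.unitE (rawE natE)))).comp
      ((CodeFP.const (rawE (rawE natE)) ()).pair (CodeFP.id (rawE (rawE natE))))).congr fun _ => rfl
  exact (CodeFP.natEq.comp ((CodeFP.natMod.comp ((((CodeFP.natLength (rawE natE)).comp hf).pair
    (CodeFP.const _ 2)))).pair (CodeFP.const _ 1))).congr fun _ => rfl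

/-- The non-empty monomials, last first, on codes. [cite: AroraBarak2009, §1.3] -/
theorem codeFP_monomialsRev : CodeFP (rawE (rawE natE)) (rawE (rawE natE))
    (fun p => (p.filter fun μ => !μ.isEmpty).reverse) := by
  have hf : CodeFP (rawE (rawE natE)) (rawE (rawE natE)) (fun p => p.filter fun μ => !μ.isEmpty) :=
    ((CodeFP.filter (σ := Unit) (α := List ℕ) (eσ := CodeFP.unitE)
      ((CodeFP.rawIsEmpty natE).comp (CodeFP.snd CodeFP.unitE (rawE natE))).not).comp
      ((CodeFP.const (rawE (rawE natE)) ()).pair (CodeFP.id (rawE (rawE natE))))).congr fun _ => rfl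
  exact (CodeFP.rawReverse (rawE natE)).comp hf

/-- **The parity program of a sparse polynomial is computed on codes in polynomial time.**
[cite: AroraBarak2009, §1.3] -/
theorem codeFP_parityRaw :
    CodeFP (rawE (rawE natE)) (rawE (pairE natE (pairE natE (pairE natE natE)))) parityRaw :=
  (codeFP_parityFold.comp (codeFP_oddBit.pair codeFP_monomialsRev)).fst'.congr fun _ => rfl

end ParityFP

/-- **The raw instance map `PEA d → PEABP`, `(n, P, k) ↦ (n, P.map parityRaw, k)`, is typed
polynomial time** between the codes of `PEA` instances and of `PEABP` instances (headed lists at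
the two outer levels, converted to raw lists and back at the boundary). [cite: AroraBarak2009, §1.3] -/
theorem stub_toPEABPRawFP : CodeFP (pairE natE (pairE (listE (listE (listE natE))) natE)) (pairE natE (pairE (listE (listE (pairE natE (pairE natE (pairE natE natE))))) natE)) toPEABPRaw := by
  -- headed ↔ raw nested lists, as in `RandPoly.codeFP_reduceRaw`
  have hraw : CodeFP (listE (listE (listE natE))) (rawE (rawE (rawE natE))) id :=
    ((CodeFP.map₀ ((CodeFP.map₀ (CodeFP.rawOfList natE)).comp (CodeFP.rawOfList (listE natE)))).comp
      (CodeFP.rawOfList (listE (listE natE)))).congr fun P => by simp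
  let ndE := pairE natE (pairE natE (pairE natE natE))
  have hhead : CodeFP (rawE (rawE ndE)) (listE (listE ndE)) id :=
    ((CodeFP.listOfRaw (listE ndE)).comp (CodeFP.map₀ (CodeFP.listOfRaw ndE))).congr fun P => by simp
  let inE := pairE natE (pairE (listE (listE (listE natE))) natE)
  have hN : CodeFP inE natE (fun c => c.1) := CodeFP.fst _ _
  have hP : CodeFP inE (rawE (rawE (rawE natE))) (fun c => c.2.1) := hraw.comp (CodeFP.snd _ _).fst'
  have hK : CodeFP inE natE (fun c => c.2.2) := (CodeFP.snd _ _).snd'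
  have hP' : CodeFP inE (listE (listE ndE)) (fun c => c.2.1.map parityRaw) :=
    hhead.comp ((CodeFP.map₀ ParityFP.codeFP_parityRaw).comp hP)
  exact (hN.pair (hP'.pair hK)).congr fun _ => rfl

end Summit.PneNP.PneNP.Cruxes.PeaThreeNotInP.SocketBP
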